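/-
Copyright (c) 2026 the pub-hodgecm-mathlib formalisation cell (harness21).  Prover seat hodgecm-mathlib-K2E3-p11 (g5), Track B «K2-LIT» ∕ h413
(`stmt-HodgeConjecture-24833`), line `K2_E3_EllipticInputs`, road «GL-[M6]-sc» brick T15-log (MIXED HALF), FILE M2: `Y ↦ |disc χ_Y|_F^{-s}` IS LOCALLY
INTEGRABLE ON `𝔤𝔩₂(F)` for every `s < 1` (Harish-Chandra's Theorem 15 on `𝔤𝔩₂`, elliptic set included).  2026-09-04.
-/
import Summits.HodgeConjecture.HodgeConjecture.Theorems.K2E3DiagonalFormRpowNegIntegrable        -- ★ M1 (this seat): `∫_{box} |Q|^{-s} < ∞`, `s < 1`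
import Summits.HodgeConjecture.HodgeConjecture.Theorems.K2E3GL2DiscrInvSqrtLocallyIntegrable     -- ★ K2E3-p12 (g3): the `s = 1∕2` file (chart `discr_charpoly_eq_ternaryForm`)
import Mathlib.MeasureTheory.Function.SpecialFunctions.Basic
import HarnessLib

/-!
# K2_E3 road (h413), «GL-[M6]-sc» brick T15-log (mixed half), FILE M2 — `|disc χ_Y|_F^{-s} ∈ L¹_loc(𝔤𝔩₂(F))` for every `s < 1`

Cell `pub/hodgecm-mathlib` (D-0151), Track B, seat K2E3-p11 (g5) (T15-log MIXED HALF, `K2/STATUS.md` 2026-09-04 07:18:47Z; road owner K2E3-p23 (g5)).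
`--supports stmt-HodgeConjecture-24833 --as helper`; THEOREMS ONLY (no definition ∕ instance ∕ notation ∕ named fact ∕ `sorry`); never imports `Cruxes/…/Lines`.
COUNT-NEUTRAL.

THE RESULT — Harish-Chandra's Theorem 15 «`|η|^{-1∕2-ε}` is locally summable» for `𝔤 = 𝔤𝔩₂(F)`, `η(Y) = disc χ_Y`, with ANY exponent `s < 1` and on ALL of `𝔤𝔩₂`
(split AND elliptic regular set): the `ε`-room the mixed half of T15-log on `𝔤𝔩₃` needs for the Levi block `𝔤𝔩₂` of `𝔭 = 𝔤𝔩₂ ⊕ 𝔤𝔩₁ ⊕ 𝔫`.  Proof = ★ p12 (g3)'s chart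
`Y ↦ ((Y₀₀ − Y₁₁, Y₀₁ + Y₁₀, Y₀₁ − Y₁₀), Y₀₀)` (`disc χ_Y = z₀² + z₁² − z₂²`, ★ `discr_charpoly_eq_ternaryForm`), Haar uniqueness, and ★ M1 on a box.
* **`lintegral_isCompact_normAbs_discr_rpow_neg_lt_top`** (`∫⁻_C |disc χ_Y|^{-s} dμ𝔤 < ∞`, `C` compact, `0 < s < 1`; `2 ≠ 0`, continuous non-trivial `ψ`);
* **`locallyIntegrable_normAbs_discr_rpow_neg`** (`[CharZero F]`).
[HarishChandra1970, Part VII §3 Thm. 15 p. 72] [HarishChandra1999AdmissibleDistributions, Thm. 4.4 p. 11, Thm. 6.1 p. 45] [Weil1965, Chap. III n° 36 Prop. 6]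
HONEST LABEL: HC_CM is proved only modulo the 7 printed citations (2 remaining named inputs: hLiu418 = stmt-HodgeConjecture-24832, h413 =
stmt-HodgeConjecture-24833) until rung 0 closes; count-neutral helper.

## References
* [HarishChandra1970] Harish-Chandra (van Dijk), *Harmonic Analysis on Reductive p-adic Groups*, LNM 162 (1970), Part VII §3 Thm. 15.
* [HarishChandra1999AdmissibleDistributions] Harish-Chandra (DeBacker–Sally), *Admissible Invariant Distributions on Reductive p-adic Groups* (1999), Thm. 4.4, Thm. 6.1.
* [Weil1965] A. Weil, *Sur la formule de Siegel dans la théorie des groupes classiques*, Acta Math. 113 (1965), Chap. III n° 36, Prop. 6.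
-/

set_option autoImplicit false
set_option linter.dupNamespace false

noncomputable section

open MeasureTheory Measure Filter Topology Set
open scoped NNReal ENNReal Matrix
open Literature.NumberTheory.Automorphic Literature.NumberTheory.Automorphic.LocalFieldHaar
open Literature.NumberTheory.GaloisRepresentations Literature.NumberTheory.GaloisRepresentations.IsNonarchimedeanLocalField
open Summit.HodgeConjecture.HodgeConjecture.Cruxes.H413.K2E3GL2DiscrInvSqrtLocallyIntegrable

namespace Summit.HodgeConjecture.HodgeConjecture.Cruxes.H413.K2E3GL2DiscrRpowNegLocallyIntegrable

variable {F : Type*} [Field F] [ValuativeRel F] [TopologicalSpace F] [IsNonarchimedeanLocalField F]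

/-! ## §2  `∫⁻_C |disc χ_Y|^{-s} dμ𝔤 < ∞` on compact sets, `s < 1` -/

set_option maxHeartbeats 1600000 in
/-- **`∫⁻_C |disc χ_Y|_F^{-s} dμ𝔤 < ∞` for every compact `C ⊂ 𝔤𝔩₂(F)` and every `0 < s < 1`** — Harish-Chandra's Theorem 15 «`|η|^{-1∕2-ε} ∈ L¹_loc`» on `𝔤𝔩₂(F)`,
INCLUDING the elliptic set (`2 ≠ 0`, `F` with a continuous non-trivial `ψ`, `μ𝔤` any additive Haar measure; `ℝ≥0`-power, `0` on the singular cone): transport to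
`F³ × F` along `Y ↦ ((Y₀₀ − Y₁₁, Y₀₁ + Y₁₀, Y₀₁ − Y₁₀), Y₀₀)` (★ p12's chart), Haar uniqueness, and ★ M1 `lintegral_piPrimePowBall_normAbs_rpow_neg_lt_top` on a box.
[cite: HarishChandra1970, Part VII §3 Thm. 15 p. 72] [cite: Weil1965, Chap. III n° 36 Prop. 6, p. 54] [cite: HarishChandra1999AdmissibleDistributions, Thm. 4.4 p. 11] -/
theorem lintegral_isCompact_normAbs_discr_rpow_neg_lt_top {ψ : AddChar F Circle} (hψ : ψ.IsContinuousNontrivial) (h2 : (2 : F) ≠ 0)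
    [MeasurableSpace (Matrix (Fin 2) (Fin 2) F)] [BorelSpace (Matrix (Fin 2) (Fin 2) F)] (μ𝔤 : Measure (Matrix (Fin 2) (Fin 2) F)) [μ𝔤.IsAddHaarMeasure]
    {C : Set (Matrix (Fin 2) (Fin 2) F)} (hC : IsCompact C) {s : ℝ} (hs0 : 0 < s) (hs1 : s < 1) :
    ∫⁻ Y in C, ((((normAbs F Y.charpoly.discr) ^ (-s) : ℝ≥0)) : ℝ≥0∞) ∂μ𝔤 < ∞ := by
  classical
  haveI : T2Space F := (isLocalField F).toT2Space
  haveI : LocallyCompactSpace F := (isLocalField F).toLocallyCompactSpace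
  haveI : SecondCountableTopology F := secondCountableTopology_localField F
  letI mF : MeasurableSpace F := borel F
  haveI : BorelSpace F := ⟨rfl⟩
  set μ : Measure F := Measure.addHaar with hμ
  -- the linear homeomorphism `e : 𝔤𝔩₂(F) ≃ F³ × F`
  have h22 : (2 : F)⁻¹ * 2 = 1 := inv_mul_cancel₀ h2
  let eA : Matrix (Fin 2) (Fin 2) F ≃+ ((Fin 3 → F) × F) :=
    { toFun := fun Y => (![Y 0 0 - Y 1 1, Y 0 1 + Y 1 0, Y 0 1 - Y 1 0], Y 0 0)
      invFun := fun z => !![z.2, (2 : F)⁻¹ * (z.1 1 + z.1 2); (2 : F)⁻¹ * (z.1 1 - z.1 2), z.2 - z.1 0]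
      left_inv := fun Y => by
        ext i j
        fin_cases i <;> fin_cases j
        · rfl
        · simp only [Matrix.cons_val_one, Matrix.cons_val_two, Matrix.head_cons, Matrix.tail_cons, Matrix.of_apply, Matrix.cons_val',
            Matrix.cons_val_zero, Matrix.cons_val_fin_one, Fin.mk_one, Fin.zero_eta]
          linear_combination (Y 0 1) * h22
        · simp only [Matrix.cons_val_one, Matrix.cons_val_two, Matrix.head_cons, Matrix.tail_cons, Matrix.of_apply, Matrix.cons_val',
            Matrix.cons_val_zero, Matrix.cons_val_fin_one, Fin.mk_one, Fin.zero_eta]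
          linear_combination (Y 1 0) * h22
        · simp only [Matrix.cons_val_zero, Matrix.of_apply, Matrix.cons_val', Matrix.cons_val_one, Matrix.cons_val_fin_one,
            Fin.mk_one, sub_sub_cancel]
      right_inv := fun z => by
        refine Prod.ext (funext fun i => ?_) ?_
        · fin_cases i
          · simp
          · simp only [Fin.mk_one, Matrix.cons_val_one, Matrix.of_apply, Matrix.cons_val', Matrix.cons_val_zero,
              Matrix.cons_val_fin_one]
            linear_combination (z.1 1) * h22
          · simp only [Matrix.cons_val_two, Matrix.tail_cons, Matrix.head_cons, Matrix.of_apply, Matrix.cons_val', Matrix.cons_val_zero,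
              Matrix.cons_val_one, Matrix.cons_val_fin_one, Fin.reduceFinMk]
            linear_combination (z.1 2) * h22
        · simp
      map_add' := fun Y Z => by
        refine Prod.ext (funext fun i => ?_) (by simp)
        fin_cases i <;> simp <;> ring }
  have h00 : Continuous fun Y : Matrix (Fin 2) (Fin 2) F => Y 0 0 := continuous_id.matrix_elem 0 0
  have h01 : Continuous fun Y : Matrix (Fin 2) (Fin 2) F => Y 0 1 := continuous_id.matrix_elem 0 1
  have h10 : Continuous fun Y : Matrix (Fin 2) (Fin 2) F => Y 1 0 := continuous_id.matrix_elem 1 0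
  have h11 : Continuous fun Y : Matrix (Fin 2) (Fin 2) F => Y 1 1 := continuous_id.matrix_elem 1 1
  have he' : Continuous fun Y : Matrix (Fin 2) (Fin 2) F => ((![Y 0 0 - Y 1 1, Y 0 1 + Y 1 0, Y 0 1 - Y 1 0] : Fin 3 → F), Y 0 0) := by
    refine continuous_prodMk.2 ⟨continuous_pi fun i => ?_, h00⟩
    fin_cases i
    · simp only [Fin.zero_eta, Matrix.cons_val_zero]; exact h00.sub h11
    · simp only [Fin.mk_one, Matrix.cons_val_one]; exact h01.add h10
    · simp only [Fin.reduceFinMk, Matrix.cons_val_two, Matrix.tail_cons, Matrix.head_cons]; exact h01.sub h10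
  have he : Continuous eA := he'
  have hz1 : ∀ i : Fin 3, Continuous fun z : (Fin 3 → F) × F => z.1 i := fun i => (continuous_apply i).comp continuous_fst
  have hesymm' : Continuous fun z : (Fin 3 → F) × F => !![z.2, (2 : F)⁻¹ * (z.1 1 + z.1 2); (2 : F)⁻¹ * (z.1 1 - z.1 2), z.2 - z.1 0] := by
    refine continuous_matrix fun i j => ?_
    fin_cases i <;> fin_cases j
    · simp only [Matrix.of_apply, Matrix.cons_val', Matrix.cons_val_fin_one]; exact continuous_snd
    · simp only [Matrix.of_apply, Matrix.cons_val', Matrix.cons_val_fin_one]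
      exact continuous_const.mul ((hz1 1).add (hz1 2))
    · simp only [Matrix.of_apply, Matrix.cons_val', Matrix.cons_val_fin_one]
      exact continuous_const.mul ((hz1 1).sub (hz1 2))
    · simp only [Matrix.of_apply, Matrix.cons_val', Matrix.cons_val_fin_one]
      exact continuous_snd.sub (hz1 0)
  have hesymm : Continuous eA.symm := hesymm'
  let eH : Matrix (Fin 2) (Fin 2) F ≃ₜ ((Fin 3 → F) × F) := Homeomorph.mk eA.toEquiv he hesymm
  let em : Matrix (Fin 2) (Fin 2) F ≃ᵐ ((Fin 3 → F) × F) := eH.toMeasurableEquiv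
  have hem : ∀ Y, em Y = eA Y := fun Y => rfl
  -- the transported measure is Haar, hence a multiple of the product Haar measure `ν₀`
  haveI : (μ𝔤.map eA).IsAddHaarMeasure := AddEquiv.isAddHaarMeasure_map μ𝔤 eA he hesymm
  set ν₀ : Measure ((Fin 3 → F) × F) := (Measure.pi fun _ : Fin 3 => μ).prod μ with hν₀
  haveI : ν₀.IsAddHaarMeasure := by rw [hν₀]; infer_instance
  have hsmul : μ𝔤.map eA = addHaarScalarFactor (μ𝔤.map eA) ν₀ • ν₀ := isAddLeftInvariant_eq_smul _ _
  -- the image of `C` lies in a box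
  have hCc : IsCompact (eA '' C) := hC.image he
  obtain ⟨n₀, hn₀⟩ : ∃ n : ℕ, eA '' C ⊆ piPrimePowBall F (Fin 3) (-(n : ℤ)) ×ˢ primePowBall F (-(n : ℤ)) := by
    have hcover : eA '' C ⊆ ⋃ n : ℕ, piPrimePowBall F (Fin 3) (-(n : ℤ)) ×ˢ primePowBall F (-(n : ℤ)) := by
      intro z _
      obtain ⟨k₁, hk₁⟩ := exists_mem_piPrimePowBall z.1
      obtain ⟨k₂, hk₂⟩ := exists_mem_piPrimePowBall (fun _ : Fin 1 => z.2)
      refine Set.mem_iUnion.2 ⟨max k₁ k₂, Set.mk_mem_prod (piPrimePowBall_antitone (by omega) hk₁) ?_⟩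
      exact primePowBall_antitone (by omega) (mem_piPrimePowBall_iff.1 hk₂ 0)
    have hdir : Directed (· ⊆ ·) fun n : ℕ => piPrimePowBall F (Fin 3) (-(n : ℤ)) ×ˢ primePowBall F (-(n : ℤ)) :=
      Monotone.directed_le fun a b hab => Set.prod_mono (piPrimePowBall_antitone (by omega)) (primePowBall_antitone (by omega))
    exact hCc.elim_directed_cover _ (fun n => (isOpen_piPrimePowBall _).prod (isOpen_primePowBall _)) hcover hdir
  set Bx : Set ((Fin 3 → F) × F) := piPrimePowBall F (Fin 3) (-(n₀ : ℤ)) ×ˢ primePowBall F (-(n₀ : ℤ)) with hBx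
  have hBxm : MeasurableSet Bx := (measurableSet_piPrimePowBall _).prod (measurableSet_primePowBall _)
  -- the weight in the new coordinates
  set c : Fin 3 → F := ![(1 : F), 1, -1] with hc
  have hc0 : ∀ i, c i ≠ 0 := fun i => by fin_cases i <;> simp [hc]
  set W : ((Fin 3 → F) × F) → ℝ≥0∞ := fun z => ((((normAbs F (∑ i, c i * z.1 i ^ 2)) ^ (-s) : ℝ≥0)) : ℝ≥0∞) with hW
  have hWe : ∀ Y : Matrix (Fin 2) (Fin 2) F, W (eA Y) = ((((normAbs F Y.charpoly.discr) ^ (-s) : ℝ≥0)) : ℝ≥0∞) := by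
    intro Y
    simp only [hW, hc, discr_charpoly_eq_ternaryForm Y]
    rfl
  have hQc : Continuous fun z : (Fin 3 → F) × F => ∑ i, c i * z.1 i ^ 2 :=
    continuous_finsetSum _ fun i _ => continuous_const.mul (((continuous_apply i).comp continuous_fst).pow 2)
  have hWm : Measurable W :=
    ENNReal.continuous_coe.measurable.comp (((continuous_normAbs.comp hQc).measurable).pow_const (-s))
  -- transport: `∫⁻_C w dμ𝔤 = ∫⁻ 1_{eC} W d(map e μ𝔤)`
  have hstep1 : ∫⁻ Y in C, ((((normAbs F Y.charpoly.discr) ^ (-s) : ℝ≥0)) : ℝ≥0∞) ∂μ𝔤 = ∫⁻ z, (eA '' C).indicator W z ∂(μ𝔤.map eA) := by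
    rw [show (μ𝔤.map eA) = μ𝔤.map em from rfl, lintegral_map_equiv, ← lintegral_indicator hC.measurableSet]
    refine lintegral_congr fun Y => ?_
    rw [hem]
    by_cases hY : Y ∈ C
    · rw [Set.indicator_of_mem hY, Set.indicator_of_mem (Set.mem_image_of_mem _ hY), hWe]
    · rw [Set.indicator_of_notMem hY, Set.indicator_of_notMem (fun h => hY ?_)]
      obtain ⟨Y', hY', hYY'⟩ := h
      rwa [← eA.injective hYY']
  rw [hstep1, hsmul, lintegral_smul_measure]
  refine ENNReal.mul_lt_top ENNReal.coe_lt_top ?_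
  -- bound by the box integral, which factors
  calc ∫⁻ z, (eA '' C).indicator W z ∂ν₀ ≤ ∫⁻ z, Bx.indicator W z ∂ν₀ := lintegral_mono fun z => Set.indicator_le_indicator_of_subset hn₀ (fun _ => zero_le) z
    _ = ∫⁻ z in Bx, W z ∂ν₀ := lintegral_indicator hBxm _
    _ = (∫⁻ x in piPrimePowBall F (Fin 3) (-(n₀ : ℤ)), ((((normAbs F (∑ i, c i * x i ^ 2)) ^ (-s) : ℝ≥0)) : ℝ≥0∞) ∂(Measure.pi fun _ : Fin 3 => μ)) *
          μ (primePowBall F (-(n₀ : ℤ))) := by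
        rw [hBx, hν₀, ← Measure.prod_restrict]
        have hfm : Measurable fun x : Fin 3 → F => ((((normAbs F (∑ i, c i * x i ^ 2)) ^ (-s) : ℝ≥0)) : ℝ≥0∞) :=
          ENNReal.continuous_coe.measurable.comp ((continuous_normAbs.comp
            (continuous_finsetSum _ fun i _ => continuous_const.mul ((continuous_apply i).pow 2))).measurable.pow_const (-s))
        have h := lintegral_prod_mul (μ := (Measure.pi fun _ : Fin 3 => μ).restrict (piPrimePowBall F (Fin 3) (-(n₀ : ℤ))))
          (ν := μ.restrict (primePowBall F (-(n₀ : ℤ))))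
          (f := fun x : Fin 3 → F => ((((normAbs F (∑ i, c i * x i ^ 2)) ^ (-s) : ℝ≥0)) : ℝ≥0∞)) (g := fun _ => 1)
          hfm.aemeasurable aemeasurable_const
        simp only [mul_one, lintegral_const, Measure.restrict_apply_univ, one_mul] at h
        exact h
    _ < ∞ := ENNReal.mul_lt_top (K2E3DiagonalFormRpowNegIntegrable.lintegral_piPrimePowBall_normAbs_rpow_neg_lt_top μ hψ h2 hc0 (by simp) _ hs0 hs1)
          (measure_primePowBall_lt_top μ _)

/-! ## §3  Local integrability -/

/-- **`Y ↦ |disc χ_Y|_F^{-s}` IS LOCALLY INTEGRABLE ON `𝔤𝔩₂(F)` for every `0 < s < 1`** (`F` a non-archimedean local field of characteristic `0` carrying a continuous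
non-trivial additive character, `μ𝔤` any additive Haar measure; `ℝ≥0`-power, `0` on the singular cone) — Harish-Chandra's Theorem 15 on `𝔤𝔩₂`, the `ε`-room
version of ★ p12's `locallyIntegrable_sqrt_normAbs_discr_inv`. [cite: HarishChandra1970, Part VII §3 Thm. 15 p. 72] [cite: HarishChandra1999AdmissibleDistributions, Thm. 4.4 p. 11] -/
theorem locallyIntegrable_normAbs_discr_rpow_neg [CharZero F] {ψ : AddChar F Circle} (hψ : ψ.IsContinuousNontrivial)
    [MeasurableSpace (Matrix (Fin 2) (Fin 2) F)] [BorelSpace (Matrix (Fin 2) (Fin 2) F)] (μ𝔤 : Measure (Matrix (Fin 2) (Fin 2) F)) [μ𝔤.IsAddHaarMeasure]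
    {s : ℝ} (hs0 : 0 < s) (hs1 : s < 1) :
    LocallyIntegrable (fun Y : Matrix (Fin 2) (Fin 2) F => ((((normAbs F Y.charpoly.discr) ^ (-s) : ℝ≥0)) : ℝ)) μ𝔤 := by
  haveI : T2Space F := (isLocalField F).toT2Space
  haveI : LocallyCompactSpace F := (isLocalField F).toLocallyCompactSpace
  haveI : LocallyCompactSpace (Matrix (Fin 2) (Fin 2) F) := Pi.locallyCompactSpace_of_finite
  have hmeas : Measurable fun Y : Matrix (Fin 2) (Fin 2) F => ((((normAbs F Y.charpoly.discr) ^ (-s) : ℝ≥0)) : ℝ) :=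
    measurable_coe_nnreal_real.comp ((continuous_normAbs.comp
      K2E3NormalizedCharBddNearSemisimpleRegular.continuous_discr_charpoly).measurable.pow_const (-s))
  rw [locallyIntegrable_iff]
  intro C hC
  refine ⟨hmeas.aestronglyMeasurable.restrict, ?_⟩
  rw [hasFiniteIntegral_iff_enorm]
  have h := lintegral_isCompact_normAbs_discr_rpow_neg_lt_top hψ two_ne_zero μ𝔤 hC hs0 hs1
  refine lt_of_le_of_lt (le_of_eq (lintegral_congr fun Y => ?_)) h
  rw [Real.enorm_eq_ofReal (NNReal.coe_nonneg _), ENNReal.ofReal_coe_nnreal]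

end Summit.HodgeConjecture.HodgeConjecture.Cruxes.H413.K2E3GL2DiscrRpowNegLocallyIntegrable

end
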